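import Mathlib
import Summits.Ventures.PercRepro.TriangleCapRowPlusTwoCases

/-!
# PercRepro — the row `m = k + 2` of the `K₄⁻`-free cherry table: `Σ_v C(d(v), 2) ≤ C(k − 1, 2) + 6` for every
`K₄⁻`-free graph with `k + 2` edges on `k ≥ 6` vertices (p3, gen 31; part 3 of the row `m = k + 2`)

The census (the engine's `k4free.out`, rows `m = k + 2`) reads `16 · 21 · 27 · 34` at `k = 6 … 9`, i.e.
`C(k − 1, 2) + 6` = the star `K_{1,k−1}` plus three disjoint leaf edges for `k ≥ 7` (the windmill `W₃` at
`k = 7`) and `K_{2,4}` at `k = 6` (the same value `16`).  **`cherries_le_choose_two_add_six_of_k4mFree`** proves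
the bound for every `k ≥ 6`: if every degree is `≤ 3` then `cherries ≤ Σ d = 2m = 2k + 4 ≤ C(k − 1, 2) + 6`;
otherwise at a vertex `v` of MAXIMUM degree `d = a + 4`, with `k = a + 5 + g`, `m = a + 7 + g`, `|R| = 2g + 6`,
the counts of TriangleCapOffPairsCount and the defect sum `Y = Σ_{p ∈ R} |avoid p|` of TriangleCapAvoid give
`4·cherries ≤ 4(C(k − 1, 2) + 6) + 2T − Y − 4ag`, and `2T ≤ Y + 4ag` in every case: `T ≥ 6` (two matching edges
avoid every matching pair: `Y ≥ 2T`), `3 ≤ T ≤ 5` (a matching pair avoids every pair off `v`: `Y ≥ |R| ≥ 8`,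
the dominating case `g = 0` forcing `T = |R| = 6`), `T = 2` with `a = 0` (two disjoint edges off `v`, or a
common vertex of degree `> 4` — TriangleCapRowPlusTwoCases), `T = 2` with `a, g ≥ 1` (`4ag ≥ 4`), `T = 1`
impossible, `T = 0` trivial.  The extremal graphs are the companion module TriangleCapStarMatch.
Axioms: standard.
-/

namespace PercRepro

namespace TriangleCap

namespace C047

open Finset

variable {V : Type*} [Fintype V] [DecidableEq V]

/-- `C(d, 2) ≤ d` for `d ≤ 3`. -/
theorem choose_two_le_self_of_le_three (d : ℕ) (h : d ≤ 3) : d.choose 2 ≤ d := by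
  interval_cases d <;> decide

/-- `2k + 4 ≤ C(k − 1, 2) + 6` for `k ≥ 6`. -/
theorem two_mul_add_four_le_choose_two_pred_add_six (k : ℕ) (hk : 6 ≤ k) :
    2 * k + 4 ≤ (k - 1).choose 2 + 6 := by
  obtain ⟨j, rfl⟩ : ∃ j, k = j + 6 := ⟨k - 6, by omega⟩
  have e : j + 6 - 1 = j + 5 := by omega
  rw [e]
  have hC := two_mul_choose_two_add (j + 5)
  nlinarith [hC]

/-- **THE ROW `m = k + 2`:** every `K₄⁻`-free graph with `k + 2` edges on `k ≥ 6` vertices has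
`Σ_v C(d(v), 2) ≤ C(k − 1, 2) + 6`. -/
theorem cherries_le_choose_two_add_six_of_k4mFree (D : SimpleGraph V) [DecidableRel D.Adj]
    (hK : K4mFree D) (hk : 6 ≤ Fintype.card V) (hm : D.edgeFinset.card = Fintype.card V + 2) :
    cherries D ≤ (Fintype.card V - 1).choose 2 + 6 := by
  by_cases hdeg : ∀ v, deg D v ≤ 3
  · -- every degree `≤ 3`: `cherries ≤ Σ d = 2m`
    have h2 : cherries D ≤ ∑ v, deg D v := by
      unfold cherries
      exact sum_le_sum (fun v _ => choose_two_le_self_of_le_three _ (hdeg v))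
    rw [sum_deg_eq, hm] at h2
    have := two_mul_add_four_le_choose_two_pred_add_six (Fintype.card V) hk
    omega
  · push Not at hdeg
    obtain ⟨u, hu⟩ := hdeg
    -- a vertex of maximum degree, of degree `≥ 4`
    obtain ⟨v, -, hmax⟩ := exists_max_image univ (deg D) ⟨u, mem_univ u⟩
    have hmax' : ∀ w, deg D w ≤ deg D v := fun w => hmax w (mem_univ w)
    have hv : 4 ≤ deg D v := by
      have := hmax' u
      omega
    -- the split of `2 Σ d²` (TriangleCapDiagonal) and the counts at `v`
    have hS := sum_adjPairsAll_deg_add D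
    have hsplit1 := sum_filter_add_sum_filter_not (adjPairsAll D) (fun p => p.1 = v)
      (fun p => deg D p.1 + deg D p.2)
    have hsplit2 := sum_filter_add_sum_filter_not ((adjPairsAll D).filter (fun p => ¬ p.1 = v))
      (fun p => p.2 = v) (fun p => deg D p.1 + deg D p.2)
    rw [filter_not_fst_filter_snd, filter_not_fst_filter_not_snd] at hsplit2
    have hfst := sum_filter_fst_deg_add D v
    have hsnd := sum_filter_snd_deg_add D v
    have hA := sum_deg_neighbors_eq D v
    have hE := two_mul_card_E_le D v
    have hT := card_T_le_deg D hK v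
    have hTR : ((offPairs D v).filter (fun p => D.Adj v p.1 ∧ D.Adj v p.2)).card ≤
      (offPairs D v).card := card_filter_le _ _
    have hRc := two_mul_card_edges_eq D v
    have hR1 := sum_R_add_sum_avoid_le D v
    have hc := two_mul_cherries_add D
    rw [sum_deg_eq] at hc
    have hdk : deg D v + 1 ≤ Fintype.card V := by
      have hsub : univ.filter (fun w => D.Adj v w) ⊆ univ.erase v := by
        intro w hw
        rw [mem_filter] at hw
        rw [mem_erase]
        exact ⟨(D.ne_of_adj hw.2).symm, mem_univ _⟩
      have h1 : deg D v ≤ (univ.erase v).card := card_le_card hsub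
      rw [card_erase_of_mem (mem_univ v), card_univ] at h1
      have h2 : 1 ≤ Fintype.card V := Fintype.card_pos_iff.mpr ⟨v⟩
      omega
    -- the combined linear bound with the defect sum
    have hmain : 2 * (∑ x, deg D x * deg D x) + (offPairs D v).card * deg D v +
        ∑ p ∈ offPairs D v, (avoid D v p).card ≤
        2 * (deg D v * deg D v) + 2 * deg D v +
          4 * ((offPairs D v).filter (fun p => D.Adj v p.1)).card +
          (offPairs D v).card * D.edgeFinset.card + (offPairs D v).card := by
      linarith [hS, hsplit1, hsplit2, hfst, hsnd, hA, hR1]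
    -- the four structural facts, instantiated
    have hsix : 6 ≤ ((offPairs D v).filter (fun p => D.Adj v p.1 ∧ D.Adj v p.2)).card →
        2 * ((offPairs D v).filter (fun p => D.Adj v p.1 ∧ D.Adj v p.2)).card ≤
          ∑ p ∈ offPairs D v, (avoid D v p).card :=
      fun h => two_mul_card_T_le_sum_avoid_of_six_le D hK v h
    have hthree : 3 ≤ ((offPairs D v).filter (fun p => D.Adj v p.1 ∧ D.Adj v p.2)).card →
        (offPairs D v).card ≤ ∑ p ∈ offPairs D v, (avoid D v p).card :=
      fun h => card_offPairs_le_sum_avoid_of_three_le D hK v h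
    have hpos : 0 < ((offPairs D v).filter (fun p => D.Adj v p.1 ∧ D.Adj v p.2)).card →
        2 ≤ ((offPairs D v).filter (fun p => D.Adj v p.1 ∧ D.Adj v p.2)).card :=
      fun h => two_le_card_T_of_pos D v h
    have hdom : deg D v + 1 = Fintype.card V →
        ((offPairs D v).filter (fun p => D.Adj v p.1 ∧ D.Adj v p.2)).card = (offPairs D v).card :=
      fun h => congrArg card (filter_T_eq_offPairs_of_deg_add_one_eq_card D h)
    have hfour : 4 ≤ D.edgeFinset.card - deg D v → deg D v ≤ D.edgeFinset.card - deg D v →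
        0 < ((offPairs D v).filter (fun p => D.Adj v p.1 ∧ D.Adj v p.2)).card →
        4 ≤ ∑ p ∈ offPairs D v, (avoid D v p).card :=
      fun h1 h2 h3 => four_le_sum_avoid_of_max_deg D v hmax'
        (by rw [card_offEdges]; exact h1) (by rw [card_offEdges]; exact h2) h3
    -- names for the quantities
    set T := ((offPairs D v).filter (fun p => D.Adj v p.1 ∧ D.Adj v p.2)).card with hTdef
    set E := ((offPairs D v).filter (fun p => D.Adj v p.1)).card with hEdef
    set Rc := (offPairs D v).card with hRcdef
    set Y := ∑ p ∈ offPairs D v, (avoid D v p).card with hYdef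
    set d := deg D v with hddef
    set m := D.edgeFinset.card with hmdef
    set k := Fintype.card V with hkdef
    set c := cherries D with hcdef
    set s2 := ∑ x, deg D x * deg D x with hs2def
    clear_value T E Rc Y d m k c s2
    have hfin : 2 * s2 + Rc * d + Y ≤ 2 * (d * d) + 2 * d + 2 * Rc + 2 * T + Rc * m + Rc := by
      linarith [hmain, hE]
    obtain ⟨a, rfl⟩ : ∃ a, d = a + 4 := ⟨d - 4, by omega⟩
    obtain ⟨g, rfl⟩ : ∃ g, k = a + 5 + g := ⟨k - (a + 5), by omega⟩
    have hm' : m = a + 7 + g := by omega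
    subst hm'
    have hRc' : Rc = 2 * g + 6 := by omega
    subst hRc'
    have e1 : a + 5 + g - 1 = a + 4 + g := by omega
    rw [e1]
    have hC := two_mul_choose_two_add (a + 4 + g)
    -- THE KEY INEQUALITY: `2T ≤ Y + 4ag` in every case
    have hkey : 2 * T ≤ Y + 4 * (a * g) := by
      by_cases h6 : 6 ≤ T
      · have := hsix h6
        omega
      · by_cases h3 : 3 ≤ T
        · have hY := hthree h3
          rcases Nat.eq_zero_or_pos g with hg | hg
          · subst hg
            have := hdom (by omega)
            omega
          · rcases Nat.eq_zero_or_pos a with ha | ha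
            · subst ha
              omega
            · have hag : a ≤ a * g := Nat.le_mul_of_pos_right a hg
              omega
        · rcases Nat.eq_zero_or_pos T with hT0 | hT0
          · omega
          · have h2 := hpos hT0
            rcases Nat.eq_zero_or_pos g with hg | hg
            · subst hg
              have := hdom (by omega)
              omega
            · rcases Nat.eq_zero_or_pos a with ha | ha
              · subst ha
                have := hfour (by omega) (by omega) hT0
                omega
              · have hag : a ≤ a * g := Nat.le_mul_of_pos_right a hg
                omega
    ring_nf at hfin hc hC hkey ⊢
    linarith [hfin, hc, hC, hkey]

/-- The row `m = k + 2` on `Fin k`, `k ≥ 6`: every `K₄⁻`-free `D` with `k + 2` edges has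
`cherries D ≤ C(k − 1, 2) + 6`. -/
theorem cherries_le_of_card_edges_eq_add_two (k : ℕ) (hk : 6 ≤ k) (D : SimpleGraph (Fin k))
    [DecidableRel D.Adj] (hK : K4mFree D) (hm : D.edgeFinset.card = k + 2) :
    cherries D ≤ (k - 1).choose 2 + 6 := by
  have := cherries_le_choose_two_add_six_of_k4mFree D hK (by simpa using hk) (by rw [hm]; simp)
  simpa using this

end C047

end TriangleCap

end PercRepro
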